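import Summits.CriticalPhenomena.Ising3D.IsingColumnFaceL11Exclusions

/-!
# The σ-cell's named irrational catalogue members as kernel facts (cell `pub-ising3x`, seat recog-1;
paper §7.3, companion of `IsingColumnFaceL11Census{,Kacx}.lean`)

HONEST FRAMING: lottery ticket; floor = tightest certified 3D Ising CFT bounds; no exact-solution
claim without a proof. Island framing: certified exclusion region at stated derivative order and
assumptions; not a determination of the 3D Ising critical exponents beyond that.

Paper §7.3, last sentence: «For the σ-cell itself the catalogue holds 4 rationals with denominator
≤ 1000 (…), 12 algebraic, 13 linear-form and 12 trigonometric members (simplest (2/5)√2·G = …) and no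
Kac, extended-Kac or named value — again a statement about the catalogue's density, not about Δσ.» The
rational, Kac, extended-Kac and named clauses are kernel facts (`rat_mem_σcell_iff_listed`,
`kac_not_mem_σcell`, `namedSigma_not_mem_σcell` of p627113; `kacx_not_mem_σcell` of p639014). This file
adds the two simplest IRRATIONAL members the recogniser's record names (frozen-recogniser run on the
σ-cell, `HOME/pub-ising3x-recog-1/gen42/s7/sig.jsonl`): the `TRG` member `(2/5)·√2·G` (height `[3, 5]`)
and the `LIN` member `(12 + 9 log 2 − 10 ζ(3))/12` (height 12) DO lie in
`σcell = [33957/65536, 16979/32768]`, with seven-digit enclosures from the tree's certified constants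
(`sqrt2_mem_sqrt2I`, `log2_mem_log2I` of `ExclusionSentencesPiForms`; `zeta3_mem_zeta3I`;
`catalan_mem_catalanI`): `(2/5)√2·G ∈ [0.5181483, 0.5181484]` — so its decimal expansion begins
`0.518148…` (the recogniser's record prints `0.5181483863…`) — and `(12 + 9 log 2 − 10 ζ(3))/12 ∈
[0.5181462, 0.5181463]`. What this says: the catalogue is dense enough at the cell's width (`1.5·10⁻⁵`)
to put closed forms of small height inside it; Theorem 1 says nothing about `Δσ`, and nothing here is a
statement about the 3D Ising model. [folklore]
lottery ticket; floor = tightest certified 3D Ising CFT bounds; no exact-solution claim without a proof.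
-/

namespace Summit.CriticalPhenomena.Ising3D
namespace ColumnFaceL11
open Set Literature.MathematicalPhysics.QuantumFieldTheory.ConformalBootstrap3D

/-! ### The simplest `TRG` member of the σ-cell: `(2/5)·√2·G` -/

/-- `√2 · G ∈ sqrt2I · catalanI` (product of the tree's certified enclosures). [folklore] -/
theorem sqrt2_mul_catalan_mem : Real.sqrt 2 * catalan ∈ InI (mulI sqrt2I catalanI) :=
  mulI_sound (by norm_num [sqrt2I]) (by norm_num [catalanI]) sqrt2_mem_sqrt2I catalan_mem_catalanI

/-- **Seven-digit enclosure:** `(2/5)·√2·G ∈ [0.5181483, 0.5181484]` (`G` = Catalan's constant; the value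
is `0.51814838638…`). [folklore] -/
theorem trg_example_enclosure :
    (2 / 5 : ℝ) * Real.sqrt 2 * catalan ∈ Icc (5181483 / 10 ^ 7 : ℝ) (5181484 / 10 ^ 7) := by
  have h := sqrt2_mul_catalan_mem
  simp only [InI, mulI, sqrt2I, catalanI, mem_Icc] at h
  push_cast at h
  rw [mem_Icc, mul_assoc]
  constructor <;> linarith [h.1, h.2]

/-- **The simplest trigonometric/`Γ`-type catalogue member of the σ-cell lies in it:**
`(2/5)·√2·G ∈ σcell = [33957/65536, 16979/32768]` (margins `5.7·10⁻⁶` below, `9.6·10⁻⁶` above).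
[folklore] -/
theorem trg_example_mem_σcell : (2 / 5 : ℝ) * Real.sqrt 2 * catalan ∈ σcell := by
  have h := trg_example_enclosure
  simp only [mem_Icc] at h
  simp only [σcell, mem_Icc]
  constructor <;> linarith [h.1, h.2]

/-! ### The simplest `LIN` member of the σ-cell: `(12 + 9 log 2 − 10 ζ(3))/12` -/

/-- **Seven-digit enclosure:** `(12 + 9 log 2 − 10 ζ(3))/12 ∈ [0.5181462, 0.5181463]` (`zeta3 = ζ(3)` by
`zeta3_eq_riemannZeta`; the value is `0.51814629945…`). [folklore] -/
theorem lin_example_enclosure :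
    (12 + 9 * Real.log 2 - 10 * zeta3) / 12 ∈ Icc (5181462 / 10 ^ 7 : ℝ) (5181463 / 10 ^ 7) := by
  have hl1 := log2_mem_log2I.1
  have hl2 := log2_mem_log2I.2
  have hz1 := zeta3_mem_zeta3I.1
  have hz2 := zeta3_mem_zeta3I.2
  simp only [log2I] at hl1 hl2
  simp only [zeta3I] at hz1 hz2
  push_cast at hl1 hl2 hz1 hz2
  rw [mem_Icc]
  constructor <;> linarith

/-- **The simplest linear-form catalogue member of the σ-cell lies in it:**
`(12 + 9 log 2 − 10 ζ(3))/12 ∈ σcell` (margins `3.6·10⁻⁶` below, `1.2·10⁻⁵` above). [folklore] -/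
theorem lin_example_mem_σcell : (12 + 9 * Real.log 2 - 10 * zeta3) / 12 ∈ σcell := by
  have h := lin_example_enclosure
  simp only [mem_Icc] at h
  simp only [σcell, mem_Icc]
  constructor <;> linarith [h.1, h.2]

/-- Both irrational examples and the four rationals `157/303, 257/496, 371/716, 414/799` are pairwise
distinct members of the σ-cell — six explicit catalogue values inside an interval of width `2⁻¹⁶`,
the density §1.6 / §7.3 speak of (the two irrational ones differ already in the sixth decimal).
[folklore] -/
theorem σcell_examples_distinct :
    (12 + 9 * Real.log 2 - 10 * zeta3) / 12 < (2 / 5 : ℝ) * Real.sqrt 2 * catalan ∧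
      (2 / 5 : ℝ) * Real.sqrt 2 * catalan < ((157 / 303 : ℚ) : ℝ) ∧
      ((257 / 496 : ℚ) : ℝ) < (12 + 9 * Real.log 2 - 10 * zeta3) / 12 := by
  have ht := trg_example_enclosure
  have hl := lin_example_enclosure
  simp only [mem_Icc] at ht hl
  push_cast
  refine ⟨by linarith [hl.2, ht.1], by linarith [ht.2], by linarith [hl.1]⟩

end ColumnFaceL11
end Summit.CriticalPhenomena.Ising3D
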